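import Summits.Ventures.PercRepro.RankDistTightBiIndep
import Summits.Ventures.PercRepro.RankLevelSetBiIndepPerElemModel

/-!
# PercRepro — THE ROW C-048 ON THE TIGHT LAYER FOR THE MODEL MATROIDS, UNCONDITIONALLY (p9, gen 20)

A consumer of the bridge `RankDistTightBiIndep`: night-1's model matroid `T_p(U_{q₀,F} ⊕ free)` satisfies the
per-element inequality (★★), hence `BiIndepMono` (`modelMatroid_biIndepMono`, unconditional), and every one of its
circuits has at least `q₀ + 1` elements (`modelMatroid_circuit_encard_ge`: a dependent set has more than `q₀` points
in `F` or more than `p ≥ q₀` points). So on the tight layer of `(p, q)` with `q + 1 ≤ q₀` its bottom sets are closed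
and the cumulative shadow inequality — the row C-048 — holds for it outright (`shadowCumulative_modelMatroid`),
together with C-025 (`rls_modelMatroid_of_tight`). These are the first unconditional non-paving instances of the row
on the tight layer (for `q₀ + 1 < p` the model is not paving). Nothing here moves any window of the crux.
-/

namespace PercRepro.RankDist

open Set Finset _root_.Matroid PercRepro.ThmH

variable {α : Type}

/-- **Every circuit of the model matroid has at least `q₀ + 1` elements** (`q₀ ≤ p`): a dependent set has more
than `q₀` points in `F` or more than `p` points. -/
theorem modelMatroid_circuit_encard_ge {E : Set α} (hE : E.Finite) (F : Set α) {q₀ p : ℕ} (hqp : q₀ ≤ p)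
    {C : Set α} (hC : (modelMatroid hE F q₀ p).IsCircuit C) : ((q₀ + 1 : ℕ) : ℕ∞) ≤ C.encard := by
  have hCE : C ⊆ E := hC.subset_ground
  have hfin : C.Finite := hE.subset hCE
  have hdep : ¬ (modelMatroid hE F q₀ p).Indep C := hC.dep.not_indep
  rw [modelMatroid_indep_iff] at hdep
  have h : q₀ + 1 ≤ C.ncard := by
    by_contra hlt
    have hlt' : C.ncard < q₀ + 1 := not_le.1 hlt
    exact hdep ⟨hCE, (Set.ncard_le_ncard Set.inter_subset_left hfin).trans (by omega), by omega⟩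
  rw [← hfin.cast_ncard_eq]
  exact_mod_cast h

variable [DecidableEq α]

/-- **C-048 on the tight layer for the model matroids**: `T_p(U_{q₀,F} ⊕ free)` on `p + q` elements, of rank `p`,
with `q + 1 ≤ q₀ ≤ p`, satisfies `ShadowCumulative _ p q` unconditionally. -/
theorem shadowCumulative_modelMatroid {E F : Set α} (hE : E.Finite) (hF : F ⊆ E) {q₀ p q : ℕ} (hqp : q₀ ≤ p)
    (hq : q + 1 ≤ q₀) (hn : E.ncard = p + q) (hr : (modelMatroid hE F q₀ p).eRank = (p : ℕ∞)) :
    haveI := modelMatroid_finite hE F q₀ p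
    ShadowCumulative (modelMatroid hE F q₀ p) p q := by
  haveI := modelMatroid_finite hE F q₀ p
  have hn' : (gr (modelMatroid hE F q₀ p)).card = p + q := by
    rw [card_gr, modelMatroid_E]; exact hn
  refine shadowCumulative_of_biIndepMono_of_circuits _ hn' hr (modelMatroid_biIndepMono hE hF q₀ p)
    (fun C hC => le_trans ?_ (modelMatroid_circuit_encard_ge hE F hqp hC))
  exact_mod_cast (show q + 2 ≤ q₀ + 1 by omega)

/-- **C-025 on the tight layer for the model matroids** (the same hypotheses). -/
theorem rls_modelMatroid_of_tight {E F : Set α} (hE : E.Finite) (hF : F ⊆ E) {q₀ p q : ℕ} (hqp : q₀ ≤ p)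
    (hq : q + 1 ≤ q₀) (hn : E.ncard = p + q) (hr : (modelMatroid hE F q₀ p).eRank = (p : ℕ∞)) :
    haveI := modelMatroid_finite hE F q₀ p
    ThmN.RLS (modelMatroid hE F q₀ p) p q := by
  haveI := modelMatroid_finite hE F q₀ p
  exact rls_of_shadowCumulative _ p q (shadowCumulative_modelMatroid hE hF hqp hq hn hr)

end PercRepro.RankDist
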